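import Summits.Parity.BatemanHorn.Theorems.BalancedSemiprimeLayer.Negative.TightAtX

/-!
# `BalancedSemiprimeLayer` (crux stmt-Parity-9469): `hasNoFixedPrimeDivisor` is load-bearing — through prime constants

Negative-side load-bearing analysis (cdisprove, refuter-cdisprove-stmt-Parity-9469-g2-0), PROVED:
the crux with the hypothesis `hasNoFixedPrimeDivisor` of `IsBatemanHornSystem` DROPPED is FALSE.
Witness: the system `(2, X)` — the prime constant `2` is irreducible in `ℤ[X]` with positive leading
coefficient and is not associated with `X`; the product `2·X` has the fixed prime divisor `2`. The
constant coordinate has degree `0`, so its sifting range `p < x^{0·(1−δ)/2} = 1` is EMPTY and it is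
"rough" for every `n`; hence the crux count of `(2, X)` is the `(X)` rough count `Φ(x, x^{(1−δ)/2})`,
its prime count is `π(x)` (`2` is prime), the excess is the `(X)`-layer `≍ δ·x/log x`, and the
tolerance is the `k = 2` one `ε·x/(log x)²`.

This is the ONLY way the hypothesis matters: for systems of polynomials of degree `≥ 1` a fixed
prime divisor empties the crux count eventually (see the sibling `Decoration.lean`,
`balancedSemiprimeLayer_imp_of_natDegree_pos`).
-/

namespace Summit.Parity.BatemanHorn.Theorems.BalancedSemiprimeLayer.Negative

open Filter Finset Polynomial Real
open scoped Topology
open Literature.NumberTheory.Sieve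

/-- The constant `2` is irreducible in `ℤ[X]`. [folklore] -/
theorem irreducible_C_two : Irreducible (C (2 : ℤ) : ℤ[X]) :=
  (Polynomial.prime_C_iff.mpr Int.prime_two).irreducible

/-- `2` and `X` are not associated (degrees differ), in both orders. [folklore] -/
theorem pairwise_not_associated_two_X :
    Pairwise fun i j => ¬Associated (![C (2 : ℤ), (X : ℤ[X])] i) (![C (2 : ℤ), (X : ℤ[X])] j) := by
  intro i j hij
  have hdeg : (C (2 : ℤ) : ℤ[X]).degree ≠ (X : ℤ[X]).degree := by
    rw [degree_C (by norm_num), degree_X]; decide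
  fin_cases i <;> fin_cases j
  · exact absurd rfl hij
  · intro h; exact hdeg (degree_eq_degree_of_associated h)
  · intro h; exact hdeg (degree_eq_degree_of_associated h).symm
  · exact absurd rfl hij

/-- **Any proof of the crux must use `hasNoFixedPrimeDivisor`** (to exclude prime constants): with
that hypothesis dropped the statement is false (witness `(2, X)`, `ε = 1`). [folklore] -/
theorem balancedSemiprimeLayer_false_without_noFixedPrimeDivisor :
    ¬ ∀ (k : ℕ) (f : Fin k → ℤ[X]), (∀ i, Irreducible (f i)) → (∀ i, 0 < (f i).leadingCoeff) →
      (Pairwise fun i j => ¬Associated (f i) (f j)) →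
        ∀ ε : ℝ, 0 < ε → ∃ δ : ℝ, 0 < δ ∧ δ ≤ 1 / 4 ∧ ∀ᶠ x : ℕ in atTop,
          (((Icc 1 x).filter (fun n : ℕ => ∀ i, 0 < (f i).eval (n : ℤ) ∧
            ∀ p ∈ range ⌈(x : ℝ) ^ (((f i).natDegree : ℝ) * (1 - δ) / 2)⌉₊,
              p.Prime → ¬ ((p : ℤ) ∣ (f i).eval (n : ℤ)))).card : ℝ) ≤
            (polyPrimeCount f x : ℝ) + ε * (x : ℝ) / Real.log x ^ k := by
  intro h
  have hirr : ∀ i, Irreducible (![C (2 : ℤ), (X : ℤ[X])] i) := by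
    intro i
    fin_cases i
    · exact irreducible_C_two
    · exact irreducible_X
  have hlc : ∀ i, 0 < (![C (2 : ℤ), (X : ℤ[X])] i).leadingCoeff := by
    intro i
    fin_cases i
    · show 0 < (C (2 : ℤ) : ℤ[X]).leadingCoeff
      rw [leadingCoeff_C]; norm_num
    · show 0 < (X : ℤ[X]).leadingCoeff
      rw [leadingCoeff_X]; norm_num
  obtain ⟨δ, hδ0, hδ, hev⟩ :=
    h 2 ![C (2 : ℤ), X] hirr hlc pairwise_not_associated_two_X 1 one_pos
  have hgt := eventually_mul_div_log_pow_lt (tendsto_layer_X hδ0.le hδ)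
    (log_ratio_pos hδ0 (by linarith)) 1 (le_refl 2)
  obtain ⟨x, h1, h2⟩ := (hev.and hgt).exists
  rw [card_cruxFilter_two_X, polyPrimeCount_two_X] at h1
  linarith

end Summit.Parity.BatemanHorn.Theorems.BalancedSemiprimeLayer.Negative
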